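import Summits.ValiantsHypothesis.ValiantsHypothesis.Theorems.FifoMatchingNNDivisionHardLocalizationSwitching

/-!
# FifoMatching · NNDivisionHard — localization, part 4/4: §8b `Q^Π_λ ∈ SwitchExposed` (CLASS W by name), §9 the PAIR SIEVE

Theorems-grade port (bytes staged by val-idea-43 g5 for a port hand) of the crux workfile `Cruxes/NNDivisionHard/Localization43.lean` rev 5
@6763e14e8ba5 (val-idea-43 g5, W6-P2 co-seat; crux `stmt-ValiantsHypothesis-21181` `FifoMatching.NNDivisionHard`; crit-9 g2 V#47 / V#53 VERIFIED KEEP) —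
the full commentary (enemy readings N19–N23, currency remarks, honest weight) stays in that workfile's module docstring; statements and
proofs below are VERBATIM, the namespace is `…Theorems.FifoMatching.Localization` and `T` is a local `abbrev` δ-equal to `XcDivision.T`.

Part 4: §8b `permSwitchFun`, ★★ `qPerm_switchExposed`, ★★★ `diagPermutahedron_three_pow_le` (by name from ✓ `SwitchFace.switchExposed_three_pow_le`);
§9 ★ `exists_nonneg_separating` (moment curve), ★★ `delLocated_of_colSep` / `colSep_decided`, ★★ `sw_colSep_of_switchSep` / `switchSep_decided`,
`orb_colSep_decided`, `qPerm_switchSep`, `qPerm_switchSep_decided`.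
-/

set_option linter.unusedVariables false
set_option linter.unusedSectionVars false
set_option linter.dupNamespace false

namespace Summit.ValiantsHypothesis.ValiantsHypothesis.Theorems.FifoMatching.Localization

open Matrix Finset
open scoped Pointwise
open Literature.Barriers.PneNP (HasEFOfSize corPolytopeGraph_top_two_pow_half_le)
open Literature.Combinatorics.Optimization (corPolytopeGraph corVec corVec_apply_diag corVec_apply_adj corVec_zero_or_one)
open Summit.ValiantsHypothesis.ValiantsHypothesis.Theorems.FifoMatching (XcDivision.dot_le_of_mem_convexHull XcDivision.convexHull_range_inter_eq)
open Summit.ValiantsHypothesis.ValiantsHypothesis.Theorems.FifoMatching.CorSandwich (threshold_lt_of_rpow_bound)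

/-! ### §8b … and `Q^Π_λ` is literally in CLASS W (`SwitchExposed`, ✓ landed `Theorems/FifoMatchingNNDivisionHardSwitchedFaceTower`):
the unswitched certificate `C = E_{aa} + Σ_{i≠a} ω(i)(E_{ia} − E_{ii})`, decided BY NAME via `SwitchFace.switchExposed_three_pow_le` -/

/-- the unit entry functional `E_{p₀}`. -/
def unitEntry {h : ℕ} (p₀ : Fin h × Fin h) : Fin h × Fin h → ℝ := fun p => if p = p₀ then 1 else 0

/-- `unitEntry p₀ ⬝ y = y p₀`. -/
theorem unitEntry_dotProduct {h : ℕ} (p₀ : Fin h × Fin h) (y : Fin h × Fin h → ℝ) : unitEntry p₀ ⬝ᵥ y = y p₀ := by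
  unfold unitEntry dotProduct
  simp [ite_mul, Finset.sum_ite_eq']

/-- the diagonal functional `Σ_l w(l) E_{ll}`. -/
def diagW {h : ℕ} (w : Fin h → ℝ) : Fin h × Fin h → ℝ := fun p => if p.2 = p.1 then w p.1 else 0

/-- `diagW w ⬝ y = Σ_l w l · y (l, l)`. -/
theorem diagW_dotProduct {h : ℕ} (w : Fin h → ℝ) (y : Fin h × Fin h → ℝ) : diagW w ⬝ᵥ y = ∑ l, w l * y (l, l) := by
  unfold diagW dotProduct
  rw [Fintype.sum_prod_type]
  refine Finset.sum_congr rfl fun l _ => ?_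
  simp [ite_mul, Finset.sum_ite_eq']

/-- the SWITCHED-FACE certificate for the diagonal permutahedron: `C = E_{aa} + Σ_l ω(l) E_{la} − Σ_l ω(l) E_{ll}`. -/
def permSwitchFun {h : ℕ} (a : Fin h) (ω : Fin h → ℝ) : Fin h × Fin h → ℝ :=
  unitEntry (a, a) - colTilt a ω - diagW ω

/-- `permSwitchFun a ω ⬝ y = y(a,a) + Σ_l ω l · y(l,a) − Σ_l ω l · y(l,l)`. -/
theorem permSwitchFun_dotProduct {h : ℕ} (a : Fin h) (ω : Fin h → ℝ) (y : Fin h × Fin h → ℝ) :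
    permSwitchFun a ω ⬝ᵥ y = y (a, a) + ∑ l, ω l * y (l, a) - ∑ l, ω l * y (l, l) := by
  unfold permSwitchFun
  rw [sub_dotProduct, sub_dotProduct, unitEntry_dotProduct, colTilt_dotProduct, diagW_dotProduct]
  ring

/-- value of the switching certificate on a vertex of `COR(K_h)`: `1` if `b a`, else `−Σ_l ω l · [b l]`. -/
theorem permSwitchFun_corVec {h : ℕ} (a : Fin h) (ω : Fin h → ℝ) (b : Fin h → Bool) :
    permSwitchFun a ω ⬝ᵥ corVec (⊤ : SimpleGraph (Fin h)) b =
      if b a then 1 else -∑ l, ω l * (if b l then 1 else 0) := by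
  rw [permSwitchFun_dotProduct]
  simp only [corVec_top_apply, Bool.and_self]
  cases hba : b a
  · simp
  · simp

/-- value of the switching certificate on a point of `Q^Π_λ` (when `ω a = 0`). -/
theorem permSwitchFun_qPerm {h : ℕ} (a : Fin h) (ω : Fin h → ℝ) (hωa : ω a = 0) (lam : ℝ) (π : Equiv.Perm (Fin h)) :
    permSwitchFun a ω ⬝ᵥ qPerm lam π =
      -(lam * (((π a : ℕ) : ℝ) + 1)) + lam * ∑ l, ω l * (((π l : ℕ) : ℝ) + 1) := by
  rw [permSwitchFun_dotProduct]
  have hcol : ∑ l, ω l * qPerm lam π (l, a) = 0 := by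
    refine Finset.sum_eq_zero fun l _ => ?_
    by_cases hl : l = a
    · subst hl
      rw [hωa, zero_mul]
    · unfold qPerm
      rw [if_neg hl, mul_zero]
  rw [hcol, add_zero]
  have hdiag : ∑ l, ω l * qPerm lam π (l, l) = -(lam * ∑ l, ω l * (((π l : ℕ) : ℝ) + 1)) := by
    rw [Finset.mul_sum, ← Finset.sum_neg_distrib]
    refine Finset.sum_congr rfl fun l _ => ?_
    unfold qPerm
    rw [if_pos rfl]
    ring
  have haa : qPerm lam π (a, a) = -(lam * (((π a : ℕ) : ℝ) + 1)) := by
    unfold qPerm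
    rw [if_pos rfl]
  rw [hdiag, haa]
  ring

open Summit.ValiantsHypothesis.ValiantsHypothesis.Theorems.FifoMatching (SwitchFace.SwitchExposed SwitchFace.switchExposed_three_pow_le) in
/-- ★★ `Q^Π_λ ∈ CLASS W` (`SwitchExposed`, h = n + 1): switched face at `a = 0`, `ω = id`. -/
theorem qPerm_switchExposed (n K : ℕ) (lam : ℝ) (hlam : 0 < lam) (e : Fin (K + 1) → Equiv.Perm (Fin (n + 1)))
    (j₀ : Fin (K + 1)) (hj₀ : e j₀ = Equiv.refl _) :
    SwitchFace.SwitchExposed n (fun j => qPerm lam (e j)) := by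
  refine ⟨0, permSwitchFun 0 (fun l => ((l : ℕ) : ℝ)), 1, fun b => ?_, fun b => ?_, j₀, fun j => ?_⟩
  · rw [permSwitchFun_corVec]
    split_ifs
    · exact le_rfl
    · have : 0 ≤ ∑ l : Fin (n + 1), ((l : ℕ) : ℝ) * (if b l then 1 else 0) :=
        Finset.sum_nonneg fun l _ => mul_nonneg (by positivity) (by split_ifs <;> norm_num)
      linarith
  · rw [permSwitchFun_corVec]
    constructor
    · intro hb
      by_contra hba
      rw [if_neg hba] at hb
      have : 0 ≤ ∑ l : Fin (n + 1), ((l : ℕ) : ℝ) * (if b l then 1 else 0) :=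
        Finset.sum_nonneg fun l _ => mul_nonneg (by positivity) (by split_ifs <;> norm_num)
      linarith
    · intro hba
      rw [if_pos hba]
  · by_cases hj : e j = Equiv.refl _
    · right
      simp only [hj, hj₀]
    · left
      have h0 : ((fun l : Fin (n + 1) => ((l : ℕ) : ℝ)) 0) = 0 := by simp
      simp only
      rw [permSwitchFun_qPerm 0 _ h0 lam (e j), permSwitchFun_qPerm 0 _ h0 lam (e j₀), hj₀]
      have hlt := sum_mul_perm_lt (Equiv.refl _) (e j) hj
      simp only [Equiv.refl_apply] at hlt ⊢
      have hπ : ∑ l : Fin (n + 1), ((l : ℕ) : ℝ) * (((e j l : ℕ) : ℝ) + 1) =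
          ∑ l : Fin (n + 1), ((l : ℕ) : ℝ) * ((e j l : ℕ) : ℝ) + ∑ l : Fin (n + 1), ((l : ℕ) : ℝ) := by
        rw [← Finset.sum_add_distrib]
        exact Finset.sum_congr rfl fun l _ => by ring
      have hω : ∑ l : Fin (n + 1), ((l : ℕ) : ℝ) * (((l : ℕ) : ℝ) + 1) =
          ∑ l : Fin (n + 1), ((l : ℕ) : ℝ) * ((l : ℕ) : ℝ) + ∑ l : Fin (n + 1), ((l : ℕ) : ℝ) := by
        rw [← Finset.sum_add_distrib]
        exact Finset.sum_congr rfl fun l _ => by ring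
      rw [hπ, hω]
      have hpa : (0 : ℝ) ≤ ((e j 0 : ℕ) : ℝ) := by positivity
      simp only [Fin.val_zero, CharP.cast_eq_zero, zero_add, mul_one]
      nlinarith [hlt, hpa, hlam]

open Summit.ValiantsHypothesis.ValiantsHypothesis.Theorems.FifoMatching (SwitchFace.SwitchExposed SwitchFace.switchExposed_three_pow_le) in
/-- ★★★ hence, BY NAME from the landed engine of CLASS W: `xc(COR(K_{n+1}) + Q^Π_λ) ≥ (3/2)^n − 1` — LINE rev 17 already decides `Q^Π`. -/
theorem diagPermutahedron_three_pow_le (n K : ℕ) (lam : ℝ) (hlam : 0 < lam) (e : Fin (K + 1) → Equiv.Perm (Fin (n + 1)))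
    (he : Function.Surjective e) (r : ℕ)
    (hEF : HasEFOfSize (corPolytopeGraph (⊤ : SimpleGraph (Fin (n + 1))) +
      convexHull ℝ (Set.range fun j => qPerm lam (e j))) r) :
    3 ^ n ≤ (r + 1) * 2 ^ n := by
  obtain ⟨j₀, hj₀⟩ := he (Equiv.refl _)
  exact SwitchFace.switchExposed_three_pow_le n K _ r (qPerm_switchExposed n K lam hlam e j₀ hj₀) hEF

/-! ## §9 THE PAIR SIEVE — class membership read off the VERTEX LIST (N23 in kernel, pair version)

A passenger is DECIDED as soon as ONE column `x₀` separates its distinct vertices (`ColSep ⊆ DelLocated`: a generic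
NONNEGATIVE column tilt along the moment curve `ω_l = t^l` has a unique optimal passenger vertex — `exists_nonneg_separating`,
`delLocated_of_colSep`), or ONE SWITCHED column does (`SwitchSep ⊆ Sw ColSep`: the data `(q_j(a,a), (q_j(l,l) − q_j(l,a))_{l≠a})`,
`sw_colSep_of_switchSep`); by §3/§7 the same on every `√h` principal minor and after every switching (`orb_colSep_decided`).
ENEMY READING (N23): a `C♭`-candidate must have, for EVERY `x₀`, two distinct vertices sharing the whole column `x₀`, and for
EVERY `a`, two distinct vertices sharing the switched column — and this on every large minor; `Q^Π_λ` fails it at every `a`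
(`qPerm_switchSep`: third, sieve-level exclusion of the diagonal permutahedron). -/


open Polynomial in
/-- ★ GENERIC NONNEGATIVE WEIGHTS (moment curve): finitely many vectors are pairwise separated by ONE nonnegative weight
vector — `ω_l = t^l` with `t` beyond every root of the (nonzero) difference polynomials `Σ_l (v_j(l) − v_k(l)) X^l`. -/
theorem exists_nonneg_separating {m J : ℕ} (v : Fin J → Fin m → ℝ) :
    ∃ ω : Fin m → ℝ, (∀ l, 0 ≤ ω l) ∧ ∀ j k, v j ≠ v k → ω ⬝ᵥ v j ≠ ω ⬝ᵥ v k := by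
  classical
  let P : Fin J → Fin J → ℝ[X] := fun j k => ∑ l : Fin m, C (v j l - v k l) * X ^ (l : ℕ)
  have hcoeff : ∀ j k (l : Fin m), (P j k).coeff l = v j l - v k l := by
    intro j k l
    simp only [P, finsetSum_coeff, coeff_C_mul, coeff_X_pow]
    rw [Finset.sum_eq_single l]
    · simp
    · intro l' _ hl'
      rw [if_neg (fun h => hl' (Fin.ext h).symm), mul_zero]
    · intro h; exact absurd (Finset.mem_univ l) h
  have hP : ∀ j k, v j ≠ v k → P j k ≠ 0 := by
    intro j k hne hzero
    apply hne
    funext l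
    have := hcoeff j k l
    rw [hzero, coeff_zero] at this
    linarith
  have heval : ∀ j k (t : ℝ), (P j k).eval t = ∑ l : Fin m, (v j l - v k l) * t ^ (l : ℕ) := by
    intro j k t
    simp only [P, eval_finsetSum, eval_mul, eval_C, eval_pow, eval_X]
  let B : Finset ℝ := Finset.univ.biUnion fun jk : Fin J × Fin J => (P jk.1 jk.2).roots.toFinset
  let t : ℝ := 1 + ∑ x ∈ B, |x|
  have hB0 : 0 ≤ ∑ x ∈ B, |x| := Finset.sum_nonneg fun x _ => abs_nonneg x
  have htB : t ∉ B := by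
    intro ht
    have h1 : |t| ≤ ∑ x ∈ B, |x| := Finset.single_le_sum (f := fun x => |x|) (fun x _ => abs_nonneg x) ht
    have h2 : t ≤ ∑ x ∈ B, |x| := le_trans (le_abs_self t) h1
    simp only [t] at h2
    linarith
  refine ⟨fun l => t ^ (l : ℕ), fun l => by positivity, fun j k hne heq => htB ?_⟩
  rw [Finset.mem_biUnion]
  refine ⟨(j, k), Finset.mem_univ _, ?_⟩
  rw [Multiset.mem_toFinset, mem_roots (hP j k hne), IsRoot.def, heval]
  have hsplit : ∑ l : Fin m, (v j l - v k l) * t ^ (l : ℕ) =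
      (∑ l : Fin m, t ^ (l : ℕ) * v j l) - ∑ l : Fin m, t ^ (l : ℕ) * v k l := by
    rw [← Finset.sum_sub_distrib]
    exact Finset.sum_congr rfl fun l _ => by ring
  rw [hsplit]
  simp only [dotProduct] at heq
  rw [heq, sub_self]

/-- CLASS `ColSep`: some column `x₀` of the passenger points separates distinct points. -/
def ColSep : PClass := fun h K q => ∃ x₀ : Fin h, ∀ j k, (∀ l, q j (l, x₀) = q k (l, x₀)) → q j = q k

/-- ★★ `ColSep ⊆ DelLocated`: a generic nonnegative column tilt has a unique optimal passenger vertex. -/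
theorem delLocated_of_colSep {h K : ℕ} {q : Fam h K} (hq : ColSep h K q) : DelLocated h K q := by
  classical
  obtain ⟨x₀, hsep⟩ := hq
  obtain ⟨ω, hω0, hωsep⟩ := exists_nonneg_separating (fun (j : Fin (K + 1)) (l : Fin h) => q j (l, x₀))
  obtain ⟨j₀, -, hj₀⟩ :=
    Finset.exists_min_image Finset.univ (fun j => ω ⬝ᵥ fun l => q j (l, x₀)) Finset.univ_nonempty
  refine delLocated_of_colTilt q x₀ ω hω0 j₀ fun j => ?_
  by_cases hj : q j = q j₀
  · exact Or.inr hj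
  · left
    have hne : (fun l => q j (l, x₀)) ≠ fun l => q j₀ (l, x₀) :=
      fun hcol => hj (hsep j j₀ fun l => congrFun hcol l)
    have hlt : ω ⬝ᵥ (fun l => q j₀ (l, x₀)) < ω ⬝ᵥ fun l => q j (l, x₀) :=
      lt_of_le_of_ne (hj₀ j (Finset.mem_univ _)) (Ne.symm (hωsep j j₀ hne))
    rw [colTilt_dotProduct, colTilt_dotProduct]
    simp only [dotProduct] at hlt
    linarith

/-- ★★ `ColSep` is DECIDED (T-currency, threshold of `delLocated_decided`). -/
theorem colSep_decided : Decided ColSep :=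
  decided_anti (fun _ _ _ hq => delLocated_of_colSep hq) delLocated_decided

/-- CLASS `SwitchSep`: for some `a`, the switched-column data `(q_j(a,a), (q_j(l,l) − q_j(l,a))_{l ≠ a})` separates distinct points. -/
def SwitchSep : PClass := fun h K q => ∃ a : Fin h, ∀ j k, q j (a, a) = q k (a, a) →
  (∀ l, l ≠ a → q j (l, l) - q j (l, a) = q k (l, l) - q k (l, a)) → q j = q k

/-- ★ `SwitchSep ⊆ Sw ColSep`: column `a` of the switched points `L_a q_j` is exactly the switched-column data. -/
theorem sw_colSep_of_switchSep {h K : ℕ} {q : Fam h K} (hq : SwitchSep h K q) : Sw ColSep h K q := by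
  obtain ⟨a, hsep⟩ := hq
  refine ⟨a, a, fun j k hcol => ?_⟩
  have hjk : q j = q k := by
    refine hsep j k ?_ fun l hl => ?_
    · have := hcol a
      simp only [Function.comp_apply, swLin_apply, and_self, if_true] at this
      linarith
    · have := hcol l
      simp only [Function.comp_apply, swLin_apply, hl, false_and, if_false, if_true] at this
      exact this
  simp only [Function.comp_apply, hjk]

/-- ★★ `SwitchSep` is DECIDED (switching functor §7 ∘ `colSep_decided`; same threshold). -/
theorem switchSep_decided : Decided SwitchSep :=
  decided_anti (fun _ _ _ hq => sw_colSep_of_switchSep hq) (decided_sw colSep_decided)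

/-- … and both sieves on every `√h` principal minor and after every switching (§3/§7). -/
theorem orb_colSep_decided : Decided (Orb ColSep) := decided_orb colSep_decided

/-- ★ `Q^Π_λ ∈ SwitchSep` at EVERY `a`: its points are diagonal and pairwise distinct on the diagonal. -/
theorem qPerm_switchSep {h K : ℕ} (lam : ℝ) (hlam : 0 < lam) (a : Fin h) (e : Fin (K + 1) → Equiv.Perm (Fin h)) :
    SwitchSep h K (fun j => qPerm lam (e j)) := by
  have key : ∀ x y : ℝ, -(lam * (x + 1)) = -(lam * (y + 1)) → x = y := by
    intro x y hxy
    have h1 : lam * (x + 1) = lam * (y + 1) := by linarith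
    have h2 := mul_left_cancel₀ hlam.ne' h1
    linarith
  refine ⟨a, fun j k haa hll => ?_⟩
  have hperm : ∀ l, (((e j) l : ℕ) : ℝ) = (((e k) l : ℕ) : ℝ) := by
    intro l
    by_cases hl : l = a
    · rw [hl]
      simp only [qPerm, if_true] at haa
      exact key _ _ haa
    · have := hll l hl
      simp only [qPerm, if_true, hl, if_false, sub_zero] at this
      exact key _ _ this
  funext p
  simp only [qPerm, hperm p.1]

/-- COROLLARY: the diagonal permutahedron is decided a third time, by the sieve. -/
theorem qPerm_switchSep_decided (lam : ℝ) (hlam : 0 < lam) (c : ℕ) :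
    ∃ h₀ : ℕ, ∀ h ≥ h₀, ∀ (K : ℕ) (e : Fin (K + 1) → Equiv.Perm (Fin h)) (r : ℕ),
      HasEFOfSize (corPolytopeGraph (⊤ : SimpleGraph (Fin h)) + convexHull ℝ (Set.range fun j => qPerm lam (e j))) r →
        T c h < r := by
  obtain ⟨h₀, H⟩ := switchSep_decided c
  refine ⟨h₀ + 1, fun h hh K e r hEF => ?_⟩
  have hpos : 0 < h := by omega
  exact H h (by omega) K _ r (qPerm_switchSep lam hlam ⟨0, hpos⟩ e) hEF

end Summit.ValiantsHypothesis.ValiantsHypothesis.Theorems.FifoMatching.Localization
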